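import Literature.Analysis.FluidPDE.PeriodicCylinderNeumannSmoothPotential
import HarnessLib

/-!
# The smooth Helmholtz–Leray decomposition on the periodic cylinder

Topic `Literature/Analysis/FluidPDE`. Theorem-only file (no definitions, no named facts); the
conclusion of the regularity theory for the weak periodic Neumann problem on the cylinder
`{r ≤ 1} × ℝ/Lℤ` (`PeriodicCylinderHelmholtz` … `PeriodicCylinderNeumannSmoothPotential`): the
`L²`-orthogonal Helmholtz projection `Q` onto gradients and the Leray projection `P = 1 − Q`
(`helmholtzProj`, `lerayProj` of `PeriodicCylinderHelmholtz`) preserve smooth `L`-periodic fields,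
and `P w` is a classical solenoidal field tangential on the wall — the operator `P` of T. Kato,
C. Y. Lai, J. Funct. Anal. **56** (1984) §2/§4 ("`P` maps `H^s(Ω)` into itself … for smooth data
the Neumann problem has smooth solutions"), the analytic input of the named fact
`Literature.Analysis.FluidPDE.KatoLai1984_periodicCylinderUniformExistence`.

* `exists_isSmoothPeriodic_helmholtzProj` — **`Q w = ∇_K q̂` with `q̂` smooth periodic** for every
  smooth periodic field `w` (the weak Neumann problem with data `(0, w)` is solved by `Q w`,
  `coe_neumannGrad_zero_left`; its potential is smooth periodic, `exists_isSmoothPeriodic_potential`);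
* `setIntegral_fderiv_apply_eq_zero_of_mem_orthogonal`, `divergence_eq_zero_of_mem_orthogonal`,
  `inner_eR_eq_zero_of_mem_orthogonal` — **the converse of `toCell_mem_gradSpace_orthogonal`**: a
  smooth periodic field orthogonal to all gradients is divergence free in the open cylinder and
  tangential on the wall (Gauss–Green with the wall flux, `setIntegral_divergence_cylinderCell_eq_wallFlux`,
  for the fields `φ v` with `φ` the periodisation of an interior test function — no wall flux, so
  `∫ φ div v = 0` and `div v = 0` by the fundamental lemma and continuity — and with
  `φ = ⟪v, x_h⟫`, whose wall flux is `∫_wall ⟪v, e_r⟫² = 0`);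
* `exists_smooth_leray_decomposition` — **`w = P w + ∇_K q̂`** with `P w` smooth periodic,
  divergence free, tangential, and `lerayProj (toCell w) = toCell (P w)`.

Mathlib/tree search: tree `setIntegral_divergence_cylinderCell_eq_wallFlux`, `cylWall_eq`,
`cylCoord_insertNth_zero_one`, `exists_cylCoord_eq`, `eR_cylCoord`, `divergence_smul_apply`,
`continuousOn_divergence_unitCylinder`, `mem_gradSpace_orthogonal_iff`, `lerayProj_add_helmholtzProj`;
Mathlib `IsOpen.ae_eq_zero_of_integral_contDiff_smul_eq_zero`, `Measure.eqOn_open_of_ae_eq`,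
`setIntegral_eq_zero_iff_of_nonneg_ae`, `closure_pi_set`, `Set.pi_univ_Icc`, `tendsto_nhds_unique`.

## References

* T. Kato, C. Y. Lai, J. Funct. Anal. 56 (1984) 15–28, §2 and §4 (i). [KatoLai1984]
* R. Temam, *Navier–Stokes Equations* (1977), Ch. I, Thm 1.4 and Rem. 1.6. [Temam1977]
-/

noncomputable section

open MeasureTheory Set Function Filter Topology TopologicalSpace WithLp Metric Module
open scoped ContDiff NNReal ENNReal InnerProductSpace RealInnerProductSpace

namespace Literature.Analysis.FluidPDE

open Literature.Analysis.FunctionSpaces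

/-- Local notation for physical space `ℝ³ = EuclideanSpace ℝ (Fin 3)`. -/
local notation "ℝ³" => EuclideanSpace ℝ (Fin 3)

/-- Local notation for the closed unit cylinder `{r ≤ 1}`. -/
local notation "𝕂" => closure (SetLike.coe unitCylinder : Set (EuclideanSpace ℝ (Fin 3)))

namespace PeriodicCylinder

variable {L : ℝ}

/-! ### The Helmholtz projection of a smooth periodic field is a smooth gradient -/

/-- **`Q w = ∇_K q̂` with `q̂` smooth periodic** for a smooth periodic field `w`. [folklore] -/
theorem exists_isSmoothPeriodic_helmholtzProj (hL : 0 < L) {w : ℝ³ → ℝ³} (hw : IsSmoothPeriodic L w) :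
    ∃ qhat : ℝ³ → ℝ, IsSmoothPeriodic L qhat ∧ helmholtzProj L (toCell L w) = toCell L (cylGrad qhat) := by
  obtain ⟨qhat, hqs, -, hG⟩ := exists_isSmoothPeriodic_potential hL (isSmoothPeriodic_const (0 : ℝ)) hw
    (by simp)
  refine ⟨qhat, hqs, ?_⟩
  rw [toCell_zero (F := ℝ)] at hG
  rw [← coe_neumannGrad_zero_left]
  exact Lp.ext (hG.trans (coeFn_toCell hqs.cylGrad.memLp).symm)

/-! ### Fields orthogonal to gradients are solenoidal and tangential -/

/-- `∫_cell Dψ(v) = 0` for a smooth periodic field `v ⊥ 𝓖` and every smooth periodic `ψ`.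
[folklore] -/
theorem setIntegral_fderiv_apply_eq_zero_of_mem_orthogonal (hL : 0 < L) {v : ℝ³ → ℝ³}
    (hv : IsSmoothPeriodic L v) (horth : toCell L v ∈ (gradSpace L)ᗮ) {ψ : ℝ³ → ℝ}
    (hψ : IsSmoothPeriodic L ψ) :
    ∫ x in (cylinderCell L : Set ℝ³), fderiv ℝ ψ x (v x) = 0 := by
  have _hL := hL
  have h := (mem_gradSpace_orthogonal_iff.1 horth) ψ hψ
  rw [← h]
  refine integral_congr_ae ?_
  filter_upwards [coeFn_toCell hv.memLp, ae_restrict_mem (cylinderCell L).isOpen.measurableSet] with x hx hxc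
  have hxU : x ∈ (unitCylinder : Set ℝ³) := cylinderCell_le_unitCylinder L hxc
  rw [hx, inner_cylGrad_right, fderivWithin_of_mem_nhds (closure_unitCylinder_mem_nhds hxU)]

/-- A continuous cut-off times a function continuous on an open set containing the support of the
cut-off is continuous. [folklore] -/
theorem continuous_mul_of_continuousOn_of_tsupport_subset {φ g : ℝ³ → ℝ} {U : Set ℝ³} (hU : IsOpen U)
    (hφ : Continuous φ) (hsupp : tsupport φ ⊆ U) (hg : ContinuousOn g U) :
    Continuous fun x => φ x * g x := by
  refine continuous_iff_continuousAt.2 fun x => ?_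
  by_cases hx : x ∈ U
  · exact hφ.continuousAt.mul (hg.continuousAt (hU.mem_nhds hx))
  · have hx' : x ∉ tsupport φ := fun h => hx (hsupp h)
    have hev : (fun y => φ y * g y) =ᶠ[𝓝 x] fun _ => 0 := by
      filter_upwards [notMem_tsupport_iff_eventuallyEq.1 hx'] with y hy
      simp only [hy, Pi.zero_apply, zero_mul]
    exact continuousAt_const.congr_of_eventuallyEq hev

/-- The derivative of a periodic field is periodic. [folklore] -/
theorem fderiv_add_smul_eZ_of_periodic {F : Type*} [NormedAddCommGroup F] [NormedSpace ℝ F] {v : ℝ³ → F}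
    (hv : IsAxiallyPeriodic L v) (x : ℝ³) : fderiv ℝ v (x + L • eZ) = fderiv ℝ v x := by
  have h : (fun y => v (y + L • eZ)) = v := funext fun y => hv y
  have h2 := congrArg (fun g => fderiv ℝ g x) h
  simp only [fderiv_comp_add_right] at h2
  exact h2

/-- **A smooth periodic field orthogonal to all gradients is divergence free in the open cylinder.**
[folklore] -/
theorem divergence_eq_zero_of_mem_orthogonal (hL : 0 < L) {v : ℝ³ → ℝ³} (hv : IsSmoothPeriodic L v)
    (horth : toCell L v ∈ (gradSpace L)ᗮ) :
    ∀ x ∈ (unitCylinder : Set ℝ³), VectorCalculus.divergence v x = 0 := by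
  have hv1 : ContDiffOn ℝ 1 v 𝕂 := hv.smooth.of_le (by exact_mod_cast le_top)
  have hcont : ContinuousOn (VectorCalculus.divergence v) (unitCylinder : Set ℝ³) :=
    continuousOn_divergence_unitCylinder hv1
  -- (i) `∫_cell φ div v = 0` for every test function `φ` on the cell
  have htest : ∀ φ : ℝ³ → ℝ, IsTestFunctionOn (cylinderCell L) φ →
      ∫ x in (cylinderCell L : Set ℝ³), φ x * VectorCalculus.divergence v x = 0 := by
    intro φ hφ
    have hΦs : ContDiff ℝ ∞ (periodize L φ) := contDiff_periodize hL hφ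
    have hΦp : IsAxiallyPeriodic L (periodize L φ) := isAxiallyPeriodic_periodize hL φ
    have hΦsp : IsSmoothPeriodic L (periodize L φ) := ⟨hΦs.contDiffOn, hΦp⟩
    set G : ℝ³ → ℝ³ := fun y => periodize L φ y • v y with hG
    have hGs : ContDiffOn ℝ 1 G 𝕂 := (hΦs.contDiffOn.of_le (by exact_mod_cast le_top)).smul hv1
    have hGp : IsAxiallyPeriodic L G := fun x => by
      have e1 : periodize L φ (x + L • eZ) = periodize L φ x := hΦp x
      have e2 : v (x + L • eZ) = v x := hv.periodic x
      change periodize L φ (x + L • eZ) • v (x + L • eZ) = periodize L φ x • v x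
      rw [e1, e2]
    have hflux := setIntegral_divergence_cylinderCell_eq_wallFlux hL.le hGs hGp
    -- no flux through the wall: `periodize φ = 0` there
    have hwall : ∫ y in cylWall L, ⟪G (cylCoord (Fin.insertNth 0 (1 : ℝ) y)), frameR (y 0)⟫ = 0 := by
      refine setIntegral_eq_zero_of_forall_eq_zero fun y _ => ?_
      have hΦ0 : periodize L φ (cylCoord (Fin.insertNth 0 (1 : ℝ) y)) = 0 := by
        show φ (axialRed L (cylCoord (Fin.insertNth 0 (1 : ℝ) y))) = 0
        refine image_eq_zero_of_notMem_tsupport fun h => ?_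
        have hmem := hφ.tsupport_subset h
        have h0 : (Fin.insertNth 0 (1 : ℝ) y : Fin 3 → ℝ) 0 = 1 := (insertNth_zero_one_apply y).1
        have hr : cylRadius (axialRed L (cylCoord (Fin.insertNth 0 (1 : ℝ) y))) = 1 := by
          rw [cylRadius_axialRed, cylRadius_cylCoord (by rw [h0]; norm_num), h0]
        have := hmem.1
        rw [hr] at this
        exact lt_irrefl _ this
      simp only [hG, hΦ0, zero_smul, inner_zero_left]
    rw [hwall] at hflux
    -- `div G = φ div v + Dφ(v)` on the cell
    have hdivG : ∀ x ∈ (cylinderCell L : Set ℝ³), VectorCalculus.divergence G x =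
        φ x * VectorCalculus.divergence v x + fderiv ℝ (periodize L φ) x (v x) := fun x hx => by
      have hxU : cylRadius x < 1 := cylinderCell_le_unitCylinder L hx
      rw [hG, divergence_smul_apply ((hΦs.differentiable (by simp)) x)
        (differentiableAt_of_contDiffOn_closure hv1 hxU), inner_gradient_eq_fderiv, periodize_eq_self hL φ hx]
    -- integrability of the two terms
    obtain ⟨δ, hδ, hmargin⟩ : ∃ δ : ℝ, 0 < δ ∧ ∀ x ∈ tsupport φ, cylRadius x ≤ 1 - δ := by
      by_cases hne : (tsupport φ).Nonempty
      · obtain ⟨x₀, hx₀, hmax⟩ := hφ.hasCompactSupport.exists_isMaxOn hne continuous_cylRadius.continuousOn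
        have h1 : cylRadius x₀ < 1 := (hφ.tsupport_subset hx₀).1
        exact ⟨1 - cylRadius x₀, by linarith, fun x hx => by have := hmax hx; simp only [mem_setOf_eq] at this; linarith⟩
      · exact ⟨1, one_pos, fun x hx => absurd ⟨x, hx⟩ hne⟩
    have hsuppU : tsupport φ ⊆ (unitCylinder : Set ℝ³) := fun x hx => by
      rw [SetLike.mem_coe, mem_unitCylinder]; linarith [hmargin x hx]
    have hI1 : IntegrableOn (fun x => φ x * VectorCalculus.divergence v x) (cylinderCell L : Set ℝ³) volume :=
      ((continuous_mul_of_continuousOn_of_tsupport_subset unitCylinder.isOpen hφ.contDiff.continuous hsuppU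
        hcont).integrable_of_hasCompactSupport hφ.hasCompactSupport.mul_right).integrableOn
    have hI2 : IntegrableOn (fun x => fderiv ℝ (periodize L φ) x (v x)) (cylinderCell L : Set ℝ³) volume := by
      have hc : ContinuousOn (fun x => fderiv ℝ (periodize L φ) x (v x)) (closure (cylinderCell L : Set ℝ³)) :=
        ((hΦs.continuous_fderiv (by simp)).continuousOn).clm_apply
          (hv.continuousOn.mono (closure_cylinderCell_subset L))
      exact (hc.integrableOn_compact (isCompact_closure_cylinderCell (L := L))).mono_set subset_closure
    rw [setIntegral_congr_fun (cylinderCell L).isOpen.measurableSet hdivG, integral_add hI1 hI2,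
      setIntegral_fderiv_apply_eq_zero_of_mem_orthogonal hL hv horth hΦsp, add_zero] at hflux
    exact hflux
  -- (ii) `div v = 0` a.e. on the cell, hence on the cell
  have hae : ∀ᵐ x, x ∈ (cylinderCell L : Set ℝ³) → VectorCalculus.divergence v x = 0 := by
    refine (cylinderCell L).isOpen.ae_eq_zero_of_integral_contDiff_smul_eq_zero
      ((hcont.mono fun x hx => cylinderCell_le_unitCylinder L hx).locallyIntegrableOn
        (cylinderCell L).isOpen.measurableSet) ?_
    intro φ hφs hφc hφU
    rw [← setIntegral_eq_integral_of_forall_compl_eq_zero (s := (cylinderCell L : Set ℝ³)) ?_]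
    · simp_rw [smul_eq_mul]
      exact htest φ ⟨hφs, hφc, hφU⟩
    · intro x hx
      have : φ x = 0 := image_eq_zero_of_notMem_tsupport fun h => hx (hφU h)
      simp [this]
  have hcell : EqOn (VectorCalculus.divergence v) (fun _ => (0 : ℝ)) (cylinderCell L : Set ℝ³) := by
    have hae' : VectorCalculus.divergence v =ᵐ[volume.restrict (cylinderCell L : Set ℝ³)] fun _ => (0 : ℝ) := by
      rw [EventuallyEq, ae_restrict_iff' (cylinderCell L).isOpen.measurableSet]
      exact hae
    exact Measure.eqOn_open_of_ae_eq hae' (cylinderCell L).isOpen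
      (hcont.mono fun x hx => cylinderCell_le_unitCylinder L hx) continuousOn_const
  -- (iii) periodicity and continuity
  have hdivp : IsAxiallyPeriodic L (VectorCalculus.divergence v) := fun x => by
    rw [← eZ_eq_single, divergence_eq_sum_fderiv_single, divergence_eq_sum_fderiv_single,
      fderiv_add_smul_eZ_of_periodic hv.periodic]
  intro x hxU
  have hxr : cylRadius x < 1 := hxU
  set n : ℤ := ⌊x 2 / L⌋ with hn
  have h0 : (n : ℝ) * L ≤ x 2 := by
    have := Int.floor_le (x 2 / L); rw [← hn] at this
    rwa [le_div_iff₀ hL] at this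
  have h1 : x 2 < (n : ℝ) * L + L := by
    have := Int.lt_floor_add_one (x 2 / L); rw [← hn] at this
    rw [div_lt_iff₀ hL] at this; linarith
  set x' : ℝ³ := x - ((n : ℝ) * L) • eZ with hx'
  have hxx' : x = x' + ((n : ℝ) * L) • eZ := by rw [hx', sub_add_cancel]
  have hx'r : cylRadius x' < 1 := by
    rw [hx', sub_eq_add_neg, ← neg_smul, cylRadius_add_smul_eZ]; exact hxr
  have hx'2 : 0 ≤ x' 2 ∧ x' 2 < L := by
    simp only [hx', PiLp.sub_apply, smul_eZ_apply_two]
    constructor <;> linarith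
  rw [hxx', hdivp.add_int_mul_smul_eZ]
  rcases hx'2.1.lt_or_eq with hpos | hzero
  · exact hcell ⟨hx'r, hpos, hx'2.2⟩
  · -- on the seam: limit along the axial direction
    have hx'U : x' ∈ (unitCylinder : Set ℝ³) := hx'r
    have hca : ContinuousAt (VectorCalculus.divergence v) x' := hcont.continuousAt (unitCylinder.isOpen.mem_nhds hx'U)
    set c : ℝ → ℝ³ := fun t => x' + t • eZ with hc
    have hcc : Continuous c := by simp only [hc]; fun_prop
    have hc0 : c 0 = x' := by simp [hc]
    have hct : Tendsto c (𝓝[>] 0) (𝓝 x') := by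
      have h := (hcc.tendsto 0).mono_left (nhdsWithin_le_nhds (s := Ioi (0 : ℝ)))
      rwa [hc0] at h
    have ht1 : Tendsto (fun t => VectorCalculus.divergence v (c t)) (𝓝[>] 0) (𝓝 (VectorCalculus.divergence v x')) :=
      hca.tendsto.comp hct
    have ht2 : Tendsto (fun t => VectorCalculus.divergence v (c t)) (𝓝[>] 0) (𝓝 0) := by
      refine tendsto_const_nhds.congr' ?_
      filter_upwards [Ioo_mem_nhdsGT hL] with t ht
      symm
      refine hcell ⟨?_, ?_, ?_⟩
      · show cylRadius (x' + t • eZ) < 1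
        rw [cylRadius_add_smul_eZ]; exact hx'r
      · show 0 < (x' + t • eZ) 2
        simp only [PiLp.add_apply, smul_eZ_apply_two]; linarith [ht.1]
      · show (x' + t • eZ) 2 < L
        simp only [PiLp.add_apply, smul_eZ_apply_two]; linarith [ht.2]
    exact tendsto_nhds_unique ht1 ht2

/-- **A smooth periodic field orthogonal to all gradients is tangential on the wall**:
`⟪v, e_r⟫ = 0` on `{r = 1}`. [folklore] -/
theorem inner_eR_eq_zero_of_mem_orthogonal (hL : 0 < L) {v : ℝ³ → ℝ³} (hv : IsSmoothPeriodic L v)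
    (horth : toCell L v ∈ (gradSpace L)ᗮ) :
    ∀ x ∈ frontier (unitCylinder : Set ℝ³), ⟪v x, eR x⟫ = 0 := by
  have hv1 : ContDiffOn ℝ 1 v 𝕂 := hv.smooth.of_le (by exact_mod_cast le_top)
  have hdiv := divergence_eq_zero_of_mem_orthogonal hL hv horth
  -- `φ = ⟪v, x_h⟫`
  set φ : ℝ³ → ℝ := fun x => ⟪v x, horizontalProj x⟫ with hφ
  have hφs : IsSmoothPeriodic L φ :=
    ⟨ContDiffOn.inner ℝ hv.smooth contDiff_horizontalProj.contDiffOn, fun x => by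
      simp only [hφ, hv.periodic x, horizontalProj_add_axialShift]⟩
  have hφ1 : ContDiffOn ℝ 1 φ 𝕂 := hφs.smooth.of_le (by exact_mod_cast le_top)
  set G : ℝ³ → ℝ³ := fun y => φ y • v y with hG
  have hGs : ContDiffOn ℝ 1 G 𝕂 := hφ1.smul hv1
  have hGp : IsAxiallyPeriodic L G := fun x => by
    have e1 : φ (x + L • eZ) = φ x := hφs.periodic x
    have e2 : v (x + L • eZ) = v x := hv.periodic x
    change φ (x + L • eZ) • v (x + L • eZ) = φ x • v x
    rw [e1, e2]
  have hflux := setIntegral_divergence_cylinderCell_eq_wallFlux hL.le hGs hGp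
  have hL0 : ∫ x in (cylinderCell L : Set ℝ³), VectorCalculus.divergence G x = 0 := by
    have hdivG : ∀ x ∈ (cylinderCell L : Set ℝ³), VectorCalculus.divergence G x = fderiv ℝ φ x (v x) := fun x hx => by
      have hxU : cylRadius x < 1 := cylinderCell_le_unitCylinder L hx
      rw [hG, divergence_smul_apply (differentiableAt_of_contDiffOn_closure hφ1 hxU)
        (differentiableAt_of_contDiffOn_closure hv1 hxU), inner_gradient_eq_fderiv,
        hdiv x (cylinderCell_le_unitCylinder L hx), mul_zero, zero_add]
    rw [setIntegral_congr_fun (cylinderCell L).isOpen.measurableSet hdivG]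
    exact setIntegral_fderiv_apply_eq_zero_of_mem_orthogonal hL hv horth hφs
  rw [hL0] at hflux
  -- the wall integrand is `⟪v(Φ(1,θ,z)), e_r(θ)⟫²`
  set P : (Fin 2 → ℝ) → ℝ³ := fun y => cylCoord (Fin.insertNth 0 (1 : ℝ) y) with hP
  set g : (Fin 2 → ℝ) → ℝ := fun y => ⟪v (P y), frameR (y 0)⟫ with hg
  have hPeq : ∀ y, P y = frameR (y 0) + (y 1) • eZ := fun y => cylCoord_insertNth_zero_one y
  have hPh : ∀ y, horizontalProj (P y) = frameR (y 0) := fun y => by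
    rw [hPeq, eZ_eq_single, horizontalProj_add_axialShift]
    ext i
    fin_cases i <;> simp [horizontalProj_apply_eq, frameR]
  have hint : ∀ y, ⟪G (P y), frameR (y 0)⟫ = g y * g y := fun y => by
    simp only [hG, hφ, real_inner_smul_left, hPh, hg]
  have hPK : ∀ y, P y ∈ 𝕂 := fun y => by
    rw [closure_unitCylinder, mem_setOf_eq, hP, cylRadius_cylCoord (by rw [(insertNth_zero_one_apply y).1]; norm_num),
      (insertNth_zero_one_apply y).1]
  have hPc : Continuous P := by
    rw [show P = fun y => frameR (y 0) + (y 1) • eZ from funext hPeq]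
    exact ((contDiff_frameR.continuous).comp (continuous_apply 0)).add ((continuous_apply 1).smul continuous_const)
  have hgc : Continuous g :=
    (hv.continuousOn.comp_continuous hPc hPK).inner ((contDiff_frameR.continuous).comp (continuous_apply 0))
  have hmeas : MeasurableSet (cylWall L) := by rw [cylWall_eq]; exact measurableSet_Icc
  have hcpt : IsCompact (cylWall L) := by rw [cylWall_eq]; exact isCompact_Icc
  have hzero : ∫ y in cylWall L, g y * g y = 0 := by
    rw [← setIntegral_congr_fun hmeas fun y _ => hint y]; exact hflux.symm
  have hgi : IntegrableOn (fun y => g y * g y) (cylWall L) volume := (hgc.mul hgc).continuousOn.integrableOn_compact hcpt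
  have hae : ∀ᵐ y ∂(volume.restrict (cylWall L)), g y * g y = 0 := by
    have h := (setIntegral_eq_zero_iff_of_nonneg_ae (Eventually.of_forall fun y => mul_self_nonneg (g y)) hgi).1 hzero
    filter_upwards [h] with y hy using hy
  -- `g = 0` on the open box, hence on the closed box
  set O : Set (Fin 2 → ℝ) := Set.pi univ fun i => Ioo ((![-Real.pi, 0] : Fin 2 → ℝ) i) ((![Real.pi, L] : Fin 2 → ℝ) i) with hO
  have hOo : IsOpen O := isOpen_set_pi finite_univ fun i _ => isOpen_Ioo
  have hOsub : O ⊆ cylWall L := by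
    rw [cylWall_eq, ← Set.pi_univ_Icc]
    exact Set.pi_mono fun i _ => Ioo_subset_Icc_self
  have hO0 : EqOn (fun y => g y * g y) (fun _ => (0 : ℝ)) O :=
    Measure.eqOn_open_of_ae_eq (ae_restrict_of_ae_restrict_of_subset hOsub hae) hOo
      (hgc.mul hgc).continuousOn continuousOn_const
  have hcl0 : EqOn (fun y => g y * g y) (fun _ => (0 : ℝ)) (closure O) := hO0.closure (hgc.mul hgc) continuous_const
  have hwall_sub : cylWall L ⊆ closure O := by
    rw [hO, closure_pi_set, cylWall_eq, ← Set.pi_univ_Icc]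
    refine Set.pi_mono fun i _ => ?_
    fin_cases i
    · show Icc (-Real.pi) Real.pi ⊆ closure (Ioo (-Real.pi) Real.pi)
      rw [closure_Ioo (by linarith [Real.pi_pos])]
    · show Icc 0 L ⊆ closure (Ioo 0 L)
      rw [closure_Ioo hL.ne]
  have hg0 : ∀ y ∈ cylWall L, g y = 0 := fun y hy => mul_self_eq_zero.1 (hcl0 (hwall_sub hy))
  -- wall points
  intro x hx
  rw [frontier_unitCylinder] at hx
  have hxr : cylRadius x = 1 := hx
  set n : ℤ := ⌊x 2 / L⌋ with hn
  have h0 : (n : ℝ) * L ≤ x 2 := by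
    have := Int.floor_le (x 2 / L); rw [← hn] at this
    rwa [le_div_iff₀ hL] at this
  have h1 : x 2 < (n : ℝ) * L + L := by
    have := Int.lt_floor_add_one (x 2 / L); rw [← hn] at this
    rw [div_lt_iff₀ hL] at this; linarith
  set x' : ℝ³ := x - ((n : ℝ) * L) • eZ with hx'
  have hxx' : x = x' + ((n : ℝ) * L) • eZ := by rw [hx', sub_add_cancel]
  have hx'r : cylRadius x' = 1 := by
    rw [hx', sub_eq_add_neg, ← neg_smul, cylRadius_add_smul_eZ]; exact hxr
  have hx'2 : x' 2 ∈ Icc 0 L := by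
    simp only [hx', PiLp.sub_apply, smul_eZ_apply_two, mem_Icc]
    constructor <;> linarith
  have heR : eR x = eR x' := by
    show (cylRadius x)⁻¹ • horizontalProj x = (cylRadius x')⁻¹ • horizontalProj x'
    rw [hxx', cylRadius_add_smul_eZ, eZ_eq_single, horizontalProj_add_axialShift]
  rw [hxx', hv.periodic.add_int_mul_smul_eZ, ← hxx', heR]
  -- `x'` in cylindrical coordinates
  have hx'K : x' ∈ 𝕂 := by rw [closure_unitCylinder, mem_setOf_eq, hx'r]
  obtain ⟨p, hp, hp0, hpx⟩ := exists_cylCoord_eq (L := L) hx'K (by rw [hx'r]; norm_num) hx'2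
  have hp0' : p 0 = 1 := by rw [← cylRadius_cylCoord hp0.le, hpx, hx'r]
  set y : Fin 2 → ℝ := ![p 1, p 2] with hy
  have hpy : (Fin.insertNth 0 (1 : ℝ) y : Fin 3 → ℝ) = p := by
    obtain ⟨e0, e1, e2⟩ := insertNth_zero_one_apply y
    funext i
    fin_cases i
    · exact e0.trans hp0'.symm
    · exact e1
    · exact e2
  have hymem : y ∈ cylWall L := by
    rw [mem_cylWall_iff]
    have hlo := hp.1
    have hhi := hp.2
    refine ⟨⟨?_, ?_⟩, ⟨?_, ?_⟩⟩
    · have := hlo 1; simpa [hy] using this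
    · have := hhi 1; simpa [hy] using this
    · have := hlo 2; simpa [hy] using this
    · have := hhi 2; simpa [hy] using this
  have h := hg0 y hymem
  have hPy : P y = x' := by rw [hP]; simp only []; rw [hpy, hpx]
  have hfr : frameR (y 0) = eR x' := by
    rw [← hpx, eR_cylCoord hp0]
    simp [hy]
  rw [hg] at h
  simp only [] at h
  rwa [hPy, hfr] at h

/-! ### The smooth Leray–Helmholtz decomposition -/

/-- **The smooth Helmholtz–Leray decomposition of a smooth periodic field**: `w = P w + ∇_K q̂`
with `q̂` smooth periodic and `P w = w − ∇_K q̂` smooth periodic, divergence free in the open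
cylinder and tangential on the wall; `Q(toCell w) = toCell (∇_K q̂)` and `P(toCell w) = toCell (P w)`
(Kato–Lai 1984 §2: `P` maps smooth fields to smooth solenoidal tangential fields). [folklore] -/
theorem exists_smooth_leray_decomposition (hL : 0 < L) {w : ℝ³ → ℝ³} (hw : IsSmoothPeriodic L w) :
    ∃ qhat : ℝ³ → ℝ, IsSmoothPeriodic L qhat ∧
      helmholtzProj L (toCell L w) = toCell L (cylGrad qhat) ∧
      lerayProj L (toCell L w) = toCell L (fun x => w x - cylGrad qhat x) ∧
      IsSmoothPeriodic L (fun x => w x - cylGrad qhat x) ∧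
      (∀ x ∈ (unitCylinder : Set ℝ³), VectorCalculus.divergence (fun y => w y - cylGrad qhat y) x = 0) ∧
      (∀ x ∈ frontier (unitCylinder : Set ℝ³), ⟪w x - cylGrad qhat x, eR x⟫ = 0) := by
  obtain ⟨qhat, hqs, hQ⟩ := exists_isSmoothPeriodic_helmholtzProj hL hw
  have hPw : IsSmoothPeriodic L (fun x => w x - cylGrad qhat x) := hw.sub hqs.cylGrad
  have hP : lerayProj L (toCell L w) = toCell L (fun x => w x - cylGrad qhat x) := by
    have h := lerayProj_add_helmholtzProj (L := L) (toCell L w)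
    rw [hQ, toCell_sub hw.memLp hqs.cylGrad.memLp] at *
    exact eq_sub_of_add_eq h
  have horth : toCell L (fun x => w x - cylGrad qhat x) ∈ (gradSpace L)ᗮ := by
    rw [← hP]; exact lerayProj_mem _
  exact ⟨qhat, hqs, hQ, hP, hPw, divergence_eq_zero_of_mem_orthogonal hL hPw horth,
    inner_eR_eq_zero_of_mem_orthogonal hL hPw horth⟩

end PeriodicCylinder

end Literature.Analysis.FluidPDE
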